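import Literature.AlgebraicGeometry.Motives.AbelianVarietyConjugate
import Literature.AlgebraicGeometry.Motives.AbelianVarietyIsoOfScheme
import Literature.AlgebraicGeometry.Motives.AbelianVarietyBaseChangeTower
import HarnessLib

/-!
# The structure maps of a base change `A ⊗_K L` and of a conjugate `A^σ` on underlying schemes;
# the tower isomorphism `A ⊗_k S ≅ (A ⊗_k k′) ⊗_{k′} S` with its effect on schemes
# (Görtz–Wedhorn I, §(4.7)–(4.8), Prop. 4.16, Remark 16.54; Milne 2005, §11 p. 108)

Topic `Literature/AlgebraicGeometry/Motives`, namespace `Literature.AlgebraicGeometry.Motives.AbelianVariety`.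
THEOREMS ONLY (no definition, no named fact, no instance; net Literature debt 0).  Cell `hodgecm-mathlib`
(D-0151), fan A, rung A-II, line `a2b-twisted-galois-model` (stub TM `stub_twistedModelOfFiniteLevel`): the
scheme-level bookkeeping needed to read Shimura's semilinear automorphisms `λ_σ ≫ (A^σ → A)` (proof of Thm. 21.4,
p. 192) against the group laws.

The group structure of a base change `A_L = A ⊗_K L` (`AbelianVariety.baseChange`) is, by construction, Mathlib's
`Functor.mapGrp` of the cartesian-monoidal functor `Over.pullback (Spec L → Spec K)` (`baseChange_toGrp`), so its unit,
multiplication and inversion are `ε ≫ F(η)`, `μ_F ≫ F(μ)`, `F(ι)` (Mathlib `Functor.obj.η_def`, `obj.μ_def`,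
`obj.ι_def`).  This file records what these are after composing with the projection `A_L → A`
(Görtz–Wedhorn I, §(4.7): a base change is computed factorwise):

* §1 `bcFunctor_map_left_fst/snd`, `ε_left_comp_fst`, **`one_baseChange_left_comp_fst`** (`0_{A_L} ↦ 0_A` over
  `Spec L → Spec K`), `one_baseChange_left_comp_snd`, `μ_left_comp_fst`, **`mul_baseChange_left_comp_fst`**
  (`m_{A_L} ≫ pr = (pr × pr) ≫ m_A`), **`inv_baseChange_left_comp_fst`**, `tensorHom_left` (the underlying map of
  `f ⊗ g` in `Sch/K` is `pullback.map`);
* §2 the same for the conjugate `A^σ = A ×_{Spec L, Spec σ} Spec L` of `Motives/AbelianVarietyConjugate`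
  (which IS a base change along `AlongHom L σ`, by `rfl`): `one/mul/inv_conjugate_left_comp_fst`, and
  `baseChangeHomFst_comp_hom` (`(A^σ → A) ≫ (A → Spec L) = (A^σ → Spec L) ≫ Spec σ`);
* §3 **`exists_iso_baseChange_baseChange_fst`**: an isomorphism of ABELIAN VARIETIES
  `e : A ⊗_k S ≅ (A ⊗_k k′) ⊗_{k′} S` over `S` (tower `k → k′ → S`) whose underlying map of schemes is the
  canonical `(x, s) ↦ ((x, s|_{k′}), s)` — `e ≫ pr ≫ pr = pr` — and which is natural in endomorphisms of `A`
  (`f_S ≫ e = e ≫ (f_{k′})_S`).  The tree's `AbelianVariety.baseChangeTowerIso` (`Motives/AbelianVarietyBaseChangeTower`)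
  is the same isomorphism obtained from Mathlib's `Over.pullbackComp` through `Functor.mapGrpNatIso`; its effect on
  underlying schemes is not recorded there (and unfolding `mapGrpNatIso` at that argument defeats the kernel), so the
  isomorphism is rebuilt here from the explicit scheme isomorphism by rigidity (`AbelianVariety.isoOfOverIso`: a
  unit-preserving isomorphism of the underlying `S`-schemes is an isomorphism of abelian varieties, Milne AV Cor. 2.2),
  as an EXISTENCE statement (no new definition).

## References

* [GortzWedhorn2020] U. Görtz, T. Wedhorn, *Algebraic Geometry I* (2nd ed. 2020), §(4.7)–(4.8), Prop. 4.16 (transitivity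
  of base change), §(14.20), Remark 16.54 (base change of group schemes / abelian varieties).
* [Milne2005ShimuraVarieties] J. S. Milne, *Introduction to Shimura varieties* (2005/2017), §11 p. 108 (`σV`, `σα`).
* [Milne1986AbelianVarieties] J. S. Milne, *Abelian Varieties* (1986), §2 Cor. 2.2 (rigidity).
-/

noncomputable section

open CategoryTheory CategoryTheory.Limits AlgebraicGeometry MonoidalCategory CartesianMonoidalCategory

universe u

namespace Literature.AlgebraicGeometry.Motives

namespace AbelianVariety

open scoped MonObj

set_option backward.isDefEq.respectTransparency false

/-! ## §1 Unit, multiplication and inversion of `A ⊗_K L` on underlying schemes -/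

section BaseChange

variable {K : Type u} [Field K] (L : Type u) [Field L] [Algebra K L]

/-- The underlying map of `F(f)` for `F = - ⊗_K L` (Mathlib `Over.pullback_map_left`, restated for `bcFunctor`).
[cite: GortzWedhorn2020, §(4.7)] -/
theorem bcFunctor_map_left_eq {X Y : SchemeOver K} (f : X ⟶ Y) :
    ((bcFunctor K L).map f).left =
      pullback.lift (pullback.fst X.hom (bcSpec K L) ≫ f.left) (pullback.snd X.hom (bcSpec K L))
        (by rw [Category.assoc, Over.w f]; exact pullback.condition) :=
  Over.pullback_map_left _ _

/-- `F(f) ≫ pr_Y = pr_X ≫ f` for `F = - ⊗_K L`. [cite: GortzWedhorn2020, §(4.7)] -/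
@[reassoc]
theorem bcFunctor_map_left_fst {X Y : SchemeOver K} (f : X ⟶ Y) :
    ((bcFunctor K L).map f).left ≫ pullback.fst Y.hom (bcSpec K L) =
      pullback.fst X.hom (bcSpec K L) ≫ f.left := by
  rw [bcFunctor_map_left_eq, pullback.lift_fst]

/-- `F(f)` is a morphism over `Spec L`. [cite: GortzWedhorn2020, §(4.7)] -/
@[reassoc]
theorem bcFunctor_map_left_snd {X Y : SchemeOver K} (f : X ⟶ Y) :
    ((bcFunctor K L).map f).left ≫ pullback.snd Y.hom (bcSpec K L) =
      pullback.snd X.hom (bcSpec K L) := by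
  rw [bcFunctor_map_left_eq, pullback.lift_snd]

/-- The unit constraint `ε : Spec L → (Spec K) ×_K Spec L` of the monoidal functor `- ⊗_K L`, composed with
the first projection, is `Spec L → Spec K`. [cite: GortzWedhorn2020, §(4.7)] -/
@[reassoc]
theorem ε_left_comp_fst :
    (Functor.LaxMonoidal.ε (bcFunctor K L)).left ≫ pullback.fst (𝟙_ (SchemeOver K)).hom (bcSpec K L) =
      bcSpec K L := by
  have w : (Functor.LaxMonoidal.ε (bcFunctor K L)).left ≫
      pullback.snd (𝟙_ (SchemeOver K)).hom (bcSpec K L) = 𝟙 _ :=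
    Over.w (Functor.LaxMonoidal.ε (bcFunctor K L))
  have hc : pullback.fst (𝟙_ (SchemeOver K)).hom (bcSpec K L) =
      pullback.snd (𝟙_ (SchemeOver K)).hom (bcSpec K L) ≫ bcSpec K L := by
    have := pullback.condition (f := (𝟙_ (SchemeOver K)).hom) (g := bcSpec K L)
    exact (Category.comp_id _).symm.trans this
  rw [hc, reassoc_of% w]

/-- **The unit of `A_L` lies over the unit of `A`**: `0_{A_L} ≫ pr_A = (Spec L → Spec K) ≫ 0_A`
(the unit of `F.mapGrp` is `ε ≫ F(η)`). [cite: GortzWedhorn2020, Remark 16.54] -/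
@[reassoc]
theorem one_baseChange_left_comp_fst (A : AbelianVariety K) :
    η[(A.baseChange L).X].left ≫ pullback.fst A.X.hom (bcSpec K L) = bcSpec K L ≫ η[A.X].left := by
  change (Functor.LaxMonoidal.ε (bcFunctor K L) ≫ (bcFunctor K L).map η[A.X]).left ≫
    pullback.fst A.X.hom (bcSpec K L) = _
  rw [Over.comp_left, Category.assoc, bcFunctor_map_left_fst, ε_left_comp_fst_assoc]

/-- The unit of `A_L` is a section of `A_L → Spec L`. [cite: GortzWedhorn2020, Remark 16.54] -/
@[reassoc]
theorem one_baseChange_left_comp_snd (A : AbelianVariety K) :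
    η[(A.baseChange L).X].left ≫ pullback.snd A.X.hom (bcSpec K L) = 𝟙 _ :=
  Over.w η[(A.baseChange L).X]

/-- The tensor constraint `μ_F : F(U) ×_L F(V) → F(U ×_K V)` of `F = - ⊗_K L`, composed with the projection to
`U ×_K V`, is `pr_U × pr_V` (Mathlib `Functor.Monoidal.μ_fst/μ_snd`). [cite: GortzWedhorn2020, §(4.7) and Prop. 4.16] -/
@[reassoc]
theorem μ_left_comp_fst (U V : SchemeOver K) :
    (Functor.LaxMonoidal.μ (bcFunctor K L) U V).left ≫ pullback.fst (U ⊗ V).hom (bcSpec K L) =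
      pullback.map ((bcFunctor K L).obj U).hom ((bcFunctor K L).obj V).hom U.hom V.hom
        (pullback.fst U.hom (bcSpec K L)) (pullback.fst V.hom (bcSpec K L)) (bcSpec K L)
        pullback.condition.symm pullback.condition.symm := by
  apply pullback.hom_ext
  · rw [pullback.lift_fst, Category.assoc]
    have h1 : pullback.fst (U ⊗ V).hom (bcSpec K L) ≫ pullback.fst U.hom V.hom =
        ((bcFunctor K L).map (fst U V)).left ≫ pullback.fst U.hom (bcSpec K L) := by
      rw [bcFunctor_map_left_fst, Over.fst_left]
    rw [h1, ← Over.comp_left_assoc, Functor.Monoidal.μ_fst, Over.fst_left]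
  · rw [pullback.lift_snd, Category.assoc]
    have h1 : pullback.fst (U ⊗ V).hom (bcSpec K L) ≫ pullback.snd U.hom V.hom =
        ((bcFunctor K L).map (snd U V)).left ≫ pullback.fst V.hom (bcSpec K L) := by
      rw [bcFunctor_map_left_fst, Over.snd_left]
    rw [h1, ← Over.comp_left_assoc, Functor.Monoidal.μ_snd, Over.snd_left]

/-- **The multiplication of `A_L` lies over that of `A`**: `m_{A_L} ≫ pr_A = (pr_A × pr_A) ≫ m_A`
(the multiplication of `F.mapGrp` is `μ_F ≫ F(m)`). [cite: GortzWedhorn2020, Remark 16.54] -/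
@[reassoc]
theorem mul_baseChange_left_comp_fst (A : AbelianVariety K) :
    μ[(A.baseChange L).X].left ≫ pullback.fst A.X.hom (bcSpec K L) =
      pullback.map (A.baseChange L).X.hom (A.baseChange L).X.hom A.X.hom A.X.hom
        (pullback.fst A.X.hom (bcSpec K L)) (pullback.fst A.X.hom (bcSpec K L)) (bcSpec K L)
        pullback.condition.symm pullback.condition.symm ≫ μ[A.X].left := by
  change (Functor.LaxMonoidal.μ (bcFunctor K L) A.X A.X ≫ (bcFunctor K L).map μ[A.X]).left ≫
    pullback.fst A.X.hom (bcSpec K L) = _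
  rw [Over.comp_left, Category.assoc, bcFunctor_map_left_fst, μ_left_comp_fst_assoc]
  rfl

/-- **The inversion of `A_L` lies over that of `A`**: `i_{A_L} ≫ pr_A = pr_A ≫ i_A`
(the inversion of `F.mapGrp` is `F(i)`). [cite: GortzWedhorn2020, Remark 16.54] -/
@[reassoc]
theorem inv_baseChange_left_comp_fst (A : AbelianVariety K) :
    ι[(A.baseChange L).X].left ≫ pullback.fst A.X.hom (bcSpec K L) =
      pullback.fst A.X.hom (bcSpec K L) ≫ ι[A.X].left := by
  change ((bcFunctor K L).map ι[A.X]).left ≫ pullback.fst A.X.hom (bcSpec K L) = _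
  rw [bcFunctor_map_left_fst]

/-- The underlying map of `f ⊗ g` in `Sch/K` is `pullback.map f g` over `Spec K`. [cite: GortzWedhorn2020, §(4.7)] -/
theorem tensorHom_left {X₁ X₂ Y₁ Y₂ : SchemeOver K} (f : X₁ ⟶ Y₁) (g : X₂ ⟶ Y₂) :
    (f ⊗ₘ g).left = pullback.map X₁.hom X₂.hom Y₁.hom Y₂.hom f.left g.left (𝟙 _)
      (by rw [Category.comp_id, Over.w f]) (by rw [Category.comp_id, Over.w g]) := by
  apply pullback.hom_ext
  · rw [pullback.lift_fst, ← Over.fst_left, ← Over.comp_left, tensorHom_fst, Over.comp_left, Over.fst_left]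
  · rw [pullback.lift_snd, ← Over.snd_left, ← Over.comp_left, tensorHom_snd, Over.comp_left, Over.snd_left]

end BaseChange

/-! ## §2 The same for the conjugate `A^σ` (a base change along `σ`) -/

section Conjugate

variable {L : Type u} [Field L] (σ : L ≃+* L) (A : AbelianVariety L)

/-- `(A^σ → A) ≫ (A → Spec L) = (A^σ → Spec L) ≫ Spec σ` (the defining cartesian square of the conjugate).
[cite: Milne2005ShimuraVarieties, §11 p. 108 («σV»)] -/
@[reassoc]
theorem baseChangeHomFst_comp_hom :
    baseChangeHomFst σ.toRingHom A.X ≫ A.X.hom =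
      (A.conjugate σ).X.hom ≫ Spec.map (CommRingCat.ofHom σ.toRingHom) :=
  pullback.condition

/-- **`0_{A^σ} ≫ (A^σ → A) = Spec σ ≫ 0_A`.** [cite: Milne2005ShimuraVarieties, §11 p. 108 («σV»)] -/
@[reassoc]
theorem one_conjugate_left_comp_fst :
    η[(A.conjugate σ).X].left ≫ baseChangeHomFst σ.toRingHom A.X =
      Spec.map (CommRingCat.ofHom σ.toRingHom) ≫ η[A.X].left :=
  one_baseChange_left_comp_fst (AlongHom L σ.toRingHom) A

/-- **`m_{A^σ} ≫ (A^σ → A) = ((A^σ → A) × (A^σ → A)) ≫ m_A`.** [cite: Milne2005ShimuraVarieties, §11 p. 108 («σV»)] -/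
@[reassoc]
theorem mul_conjugate_left_comp_fst :
    μ[(A.conjugate σ).X].left ≫ baseChangeHomFst σ.toRingHom A.X =
      pullback.map (A.conjugate σ).X.hom (A.conjugate σ).X.hom A.X.hom A.X.hom
        (baseChangeHomFst σ.toRingHom A.X) (baseChangeHomFst σ.toRingHom A.X)
        (Spec.map (CommRingCat.ofHom σ.toRingHom))
        pullback.condition.symm pullback.condition.symm ≫ μ[A.X].left :=
  mul_baseChange_left_comp_fst (AlongHom L σ.toRingHom) A

/-- **`i_{A^σ} ≫ (A^σ → A) = (A^σ → A) ≫ i_A`.** [cite: Milne2005ShimuraVarieties, §11 p. 108 («σV»)] -/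
@[reassoc]
theorem inv_conjugate_left_comp_fst :
    ι[(A.conjugate σ).X].left ≫ baseChangeHomFst σ.toRingHom A.X =
      baseChangeHomFst σ.toRingHom A.X ≫ ι[A.X].left :=
  inv_baseChange_left_comp_fst (AlongHom L σ.toRingHom) A

/-- `Spec σ` is an isomorphism for a ring automorphism `σ` (functoriality of `Spec`). [cite: Hartshorne1977, II Prop. 2.3 (functoriality of Spec)] -/
theorem isIso_specMap_ringEquiv : IsIso (Spec.map (CommRingCat.ofHom σ.toRingHom)) := by
  change IsIso (Scheme.Spec.map (Quiver.Hom.op σ.toCommRingCatIso.hom))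
  infer_instance

/-- `A^σ → A` is an isomorphism of schemes (base change of the isomorphism `Spec σ`). [cite: GortzWedhorn2020, §(4.7) (base change of an isomorphism)] -/
theorem isIso_baseChangeHomFst : IsIso (baseChangeHomFst σ.toRingHom A.X) := by
  haveI := isIso_specMap_ringEquiv σ
  change IsIso (pullback.fst A.X.hom (Spec.map (CommRingCat.ofHom σ.toRingHom)))
  infer_instance

end Conjugate

/-! ## §3 The tower isomorphism `A ⊗_k S ≅ (A ⊗_k k′) ⊗_{k′} S` and its underlying map of schemes -/

section Tower

variable {k : Type u} (k' S : Type u) [Field k] [Field k'] [Field S] [Algebra k k'] [Algebra k' S] [Algebra k S]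
  [IsScalarTower k k' S]

/-- **Transitivity of base change for abelian varieties, with its effect on schemes.**  For a tower of fields
`k → k′ → S` and an abelian variety `A` over `k` there is an isomorphism of abelian varieties over `S`,
`e : A ⊗_k S ≅ (A ⊗_k k′) ⊗_{k′} S`, whose underlying isomorphism of schemes is the canonical
`A ×_k Spec S ≅ (A ×_k Spec k′) ×_{k′} Spec S`, `(x, s) ↦ ((x, s|_{k′}), s)` — so `e ≫ pr ≫ pr = pr` onto `A` —
and which commutes with the base changes of the endomorphisms of `A`: `f_S ≫ e = e ≫ (f_{k′})_S`
(Görtz–Wedhorn I, Prop. 4.16 / §(4.8) «transitivity of base change» and Remark 16.54; the homomorphism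
property by rigidity, Milne AV Cor. 2.2, the scheme isomorphism preserving the unit).
[cite: GortzWedhorn2020, Prop. 4.16, §(4.8) and Remark 16.54] [cite: Milne1986AbelianVarieties, §2 Cor. 2.2] -/
theorem exists_iso_baseChange_baseChange_fst (A : AbelianVariety k) :
    ∃ e : A.baseChange S ≅ (A.baseChange k').baseChange S,
      Hom.toSchemeHom e.hom ≫ pullback.fst (A.baseChange k').X.hom (bcSpec k' S) ≫
          pullback.fst A.X.hom (bcSpec k k') = pullback.fst A.X.hom (bcSpec k S) ∧
      ∀ f : A ⟶ A, Hom.baseChange S f ≫ e.hom = e.hom ≫ Hom.baseChange S (Hom.baseChange k' f) := by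
  have htower : bcSpec k' S ≫ bcSpec k k' = bcSpec k S := bcSpec_comp_bcSpec_of_isScalarTower k k' S
  -- the explicit scheme isomorphism
  let inner : pullback A.X.hom (bcSpec k S) ⟶ pullback A.X.hom (bcSpec k k') :=
    pullback.lift (pullback.fst A.X.hom (bcSpec k S)) (pullback.snd A.X.hom (bcSpec k S) ≫ bcSpec k' S)
      (by rw [Category.assoc, htower]; exact pullback.condition)
  have hinner_fst : inner ≫ pullback.fst A.X.hom (bcSpec k k') = pullback.fst A.X.hom (bcSpec k S) :=
    pullback.lift_fst _ _ _
  have hinner_snd : inner ≫ pullback.snd A.X.hom (bcSpec k k') =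
      pullback.snd A.X.hom (bcSpec k S) ≫ bcSpec k' S :=
    pullback.lift_snd _ _ _
  let hom : pullback A.X.hom (bcSpec k S) ⟶ pullback (A.baseChange k').X.hom (bcSpec k' S) :=
    pullback.lift inner (pullback.snd A.X.hom (bcSpec k S)) hinner_snd
  have hhom_fst : hom ≫ pullback.fst (A.baseChange k').X.hom (bcSpec k' S) = inner := pullback.lift_fst _ _ _
  have hhom_snd : hom ≫ pullback.snd (A.baseChange k').X.hom (bcSpec k' S) = pullback.snd A.X.hom (bcSpec k S) :=
    pullback.lift_snd _ _ _
  let inv : pullback (A.baseChange k').X.hom (bcSpec k' S) ⟶ pullback A.X.hom (bcSpec k S) :=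
    pullback.lift (pullback.fst (A.baseChange k').X.hom (bcSpec k' S) ≫ pullback.fst A.X.hom (bcSpec k k'))
      (pullback.snd (A.baseChange k').X.hom (bcSpec k' S))
      (by rw [Category.assoc, pullback.condition, ← htower, ← Category.assoc, ← Category.assoc]
          congr 1
          exact pullback.condition)
  have hinv_fst : inv ≫ pullback.fst A.X.hom (bcSpec k S) =
      pullback.fst (A.baseChange k').X.hom (bcSpec k' S) ≫ pullback.fst A.X.hom (bcSpec k k') :=
    pullback.lift_fst _ _ _
  have hinv_snd : inv ≫ pullback.snd A.X.hom (bcSpec k S) = pullback.snd (A.baseChange k').X.hom (bcSpec k' S) :=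
    pullback.lift_snd _ _ _
  let E : (A.baseChange S).X.left ≅ ((A.baseChange k').baseChange S).X.left :=
    { hom := hom
      inv := inv
      hom_inv_id := by
        apply pullback.hom_ext
        · rw [Category.assoc, hinv_fst, reassoc_of% hhom_fst, hinner_fst, Category.id_comp]
        · rw [Category.assoc, hinv_snd, hhom_snd, Category.id_comp]
      inv_hom_id := by
        apply pullback.hom_ext
        · rw [Category.assoc, hhom_fst, Category.id_comp]
          apply pullback.hom_ext
          · rw [Category.assoc, hinner_fst, hinv_fst]
          · rw [Category.assoc, hinner_snd, reassoc_of% hinv_snd]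
            exact pullback.condition.symm
        · rw [Category.assoc, hhom_snd, hinv_snd, Category.id_comp] }
  let Eo : (A.baseChange S).X ≅ ((A.baseChange k').baseChange S).X := Over.isoMk E hhom_snd
  -- the unit is preserved
  have hunit : η[(A.baseChange S).X] ≫ Eo.hom = η[((A.baseChange k').baseChange S).X] := by
    ext : 1
    rw [Over.comp_left]
    change η[(A.baseChange S).X].left ≫ hom = _
    apply pullback.hom_ext
    · rw [Category.assoc, hhom_fst, one_baseChange_left_comp_fst]
      apply pullback.hom_ext
      · rw [Category.assoc, hinner_fst, one_baseChange_left_comp_fst, Category.assoc,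
          one_baseChange_left_comp_fst, ← Category.assoc, htower]
      · rw [Category.assoc, hinner_snd, one_baseChange_left_comp_snd_assoc, Category.assoc,
          one_baseChange_left_comp_snd]
        exact (Category.comp_id _).symm
    · rw [Category.assoc, hhom_snd, one_baseChange_left_comp_snd, one_baseChange_left_comp_snd]
  refine ⟨isoOfOverIso Eo hunit, ?_, fun f => ?_⟩
  · change hom ≫ _ ≫ _ = _
    rw [reassoc_of% hhom_fst, hinner_fst]
  · refine AbelianVariety.hom_ext _ _ (Over.OverMorphism.ext ?_)
    change Hom.toSchemeHom (Hom.baseChange S f) ≫ hom =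
      hom ≫ Hom.toSchemeHom (Hom.baseChange S (Hom.baseChange k' f))
    apply pullback.hom_ext
    · rw [Category.assoc, Category.assoc, hhom_fst, toSchemeHom_baseChange_comp_fst, reassoc_of% hhom_fst]
      apply pullback.hom_ext
      · rw [Category.assoc, Category.assoc, hinner_fst, toSchemeHom_baseChange_comp_fst,
          toSchemeHom_baseChange_comp_fst, reassoc_of% hinner_fst]
      · rw [Category.assoc, Category.assoc, hinner_snd, toSchemeHom_baseChange_comp_snd_assoc,
          toSchemeHom_baseChange_comp_snd, hinner_snd]
    · rw [Category.assoc, Category.assoc, hhom_snd, toSchemeHom_baseChange_comp_snd,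
        toSchemeHom_baseChange_comp_snd, hhom_snd]

end Tower

end AbelianVariety

end Literature.AlgebraicGeometry.Motives

end
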